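/-
 # DB-SYM, VERTEX FORM — the TM room is 81 cells (strengthen g7, 2026-08-29)

 `import`s the kernel file of record `DepthBoundA4` (v1.8) and adds, in its namespace:

 §1 colour-1's two-moment functional `G_t = R₃ + t·Q₂` (bus l.8626 ∕ l.8699) in CO-LEVEL coordinates `(c, δ) = (|x|+|y|, 2|xy|)`
    (`Gt`, `GtC`) and in WORD form `GtW = (42 − 3t)·S1 + (2t − 28)·S2 − S3 + 3·S4` over the 26 e-free words of degrees 2∕3 of the file;
    `GtW_eq_GtC` (identity on the height-14 alphabet) and `GtC_rows`: the (A1).2 rows of `DBSymProfile` give `Σ_N m·G_t = 64·G_t(x₀)`.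
 §2 THE TRIANGLE LEMMA: for a factor of type `(p, q)` (`P = p − 1 ≤ Q = q − 1`) every N-letter `(u, v)` lies in the STRICT-SHRINK box
    (`N_in_box`, from `N_above_orbit` + `strict_shrink`), and `P Q² · (1, c, δ)(u,v)` is the combination of the three VERTEX letters
    hub `o = (0,0)`, axis tip `a = (Q,0)`, retreat `F = (P+Q, 2PQ)` with the polynomial weights `Wo = P(Q−u)(Q−v)`, `Wa = PQ(u+v) − (P+Q)uv`,
    `WF = Q·uv`, all `≥ 0` on the box (`W_nonneg`); since `G_t` is affine in each factor's `(1, c_f, δ_f)` (`bary_slot0..3`, `ring`),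
    a bound `g ≤ 135·G_t` on the `3⁴ = 81` vertex cells propagates to every coverer cell (`hull_fat`; thin types: segment `{o, a}`, `hull_thin`).
 §3 DB-SYM FOR ISOTYPIC PROFILES: if the four letters of `x₀` have one type `(p,q)` up to the quarter-turn (`Iso p q x₀`), then with the
    uniform integer `t = p + q − 1 − min(p,4)` the 81 (resp. 16) vertex inequalities `64·G_t(x₀) + 1 ≤ 135·G_t(k)` and `G_t(x₀) < 0` are
    `decide`d per type and `Σ_N m ≤ 135`, `72 ≤ Σ_N m` (`sumN_window`) close the contradiction: `dbSymProfile_iso` — all 49 types `(p,q)`,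
    `1 ≤ p ≤ q`, `p + q ≤ 14`.  The general (mixed-profile) `DBSymProfile` ∕ `stub_DBSym` stay OPEN; by §2 it is, per profile, an LP on 81 cells.

 0 sorry · no new axioms · no `native_decide` · `decide` only on closed integer arithmetic.  Nothing here is a rung toward HC ∕ HC_AV ∕ 18881.
-/
import Summits.HodgeConjecture.HodgeConjecture.Cruxes.BlochSeedDiscOne.DepthBoundA4

namespace Summit.HodgeConjecture.HodgeConjecture.Cruxes.BlochSeedDiscOne.DepthBoundA4

section vertexform

/-! ## §1 The functional `G_t` -/

/-- colour-1's `G_t = R₃ + t·Q₂` as a polynomial in the co-levels `c_f` and the `δ_f = 2|x_f y_f|`: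
`Q₂ = 2e₂(c) − 3Σδ`, `R₃ = Σ_{f≠g} δ_f c_g − 3e₃(c)`. -/
def Gt (t c0 c1 c2 c3 d0 d1 d2 d3 : ℤ) : ℤ :=
  (d0 * (c1 + c2 + c3) + d1 * (c0 + c2 + c3) + d2 * (c0 + c1 + c3) + d3 * (c0 + c1 + c2))
  - 3 * (c1 * c2 * c3 + c0 * c2 * c3 + c0 * c1 * c3 + c0 * c1 * c2)
  + t * (2 * (c0 * c1 + c0 * c2 + c0 * c3 + c1 * c2 + c1 * c3 + c2 * c3) - 3 * (d0 + d1 + d2 + d3))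

/-- `δ = 2|x||y|` of a letter. -/
def dlt (ℓ : Letter) : ℤ := 2 * (|ℓ.x| * |ℓ.y|)

/-- `G_t` of a cell, co-level side. -/
def GtC (t : ℤ) (c : Cell) : ℤ :=
  Gt t (c 0).colevel (c 1).colevel (c 2).colevel (c 3).colevel (dlt (c 0)) (dlt (c 1)) (dlt (c 2)) (dlt (c 3))

/-- `G_t` of a cell, word side (the 26 e-free words of degrees 2 and 3). -/
def GtW (t : ℤ) (c : Cell) : ℤ := (42 - 3 * t) * S1 c + (2 * t - 28) * S2 c - S3 c + 3 * S4 c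

theorem a_of_alphabet14 (ℓ : Letter) (h : ℓ.OnAlphabet 14) : ℓ.a = 14 - ℓ.colevel := by
  obtain ⟨hh, _⟩ := h
  unfold Letter.height at hh
  unfold Letter.colevel
  linarith

theorem selfInt_of_alphabet14 (ℓ : Letter) (h : ℓ.OnAlphabet 14) :
    ℓ.selfInt = (14 - ℓ.colevel) ^ 2 - ℓ.colevel ^ 2 + dlt ℓ := by
  have ha := a_of_alphabet14 ℓ h
  have hx2 : ℓ.x ^ 2 = |ℓ.x| ^ 2 := (sq_abs ℓ.x).symm
  have hy2 : ℓ.y ^ 2 = |ℓ.y| ^ 2 := (sq_abs ℓ.y).symm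
  unfold Letter.selfInt Letter.bnorm dlt
  rw [hx2, hy2, ha]
  unfold Letter.colevel
  ring

/-- On the height-14 alphabet the word form and the co-level form agree. -/
theorem GtW_eq_GtC (t : ℤ) (c : Cell) (h : ∀ f : Fin 4, (c f).OnAlphabet 14) : GtW t c = GtC t c := by
  simp only [GtW, S1, S2, S3, S4, icellCoef_w3P0, icellCoef_w3P1, icellCoef_w3P2, icellCoef_w3P3,
    icellCoef_w3H01, icellCoef_w3H02, icellCoef_w3H03, icellCoef_w3H12, icellCoef_w3H13, icellCoef_w3H23,
    icellCoef_w3PH01, icellCoef_w3PH02, icellCoef_w3PH03, icellCoef_w3PH10, icellCoef_w3PH12, icellCoef_w3PH13,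
    icellCoef_w3PH20, icellCoef_w3PH21, icellCoef_w3PH23, icellCoef_w3PH30, icellCoef_w3PH31, icellCoef_w3PH32,
    icellCoef_w3T0, icellCoef_w3T1, icellCoef_w3T2, icellCoef_w3T3]
  rw [a_of_alphabet14 _ (h 0), a_of_alphabet14 _ (h 1), a_of_alphabet14 _ (h 2), a_of_alphabet14 _ (h 3),
    selfInt_of_alphabet14 _ (h 0), selfInt_of_alphabet14 _ (h 1), selfInt_of_alphabet14 _ (h 2), selfInt_of_alphabet14 _ (h 3)]
  unfold GtC Gt
  ring

theorem linZ_GtW (L : List (Cell × ℕ)) (t : ℤ) :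
    linZ L (GtW t) = (42 - 3 * t) * linZ L S1 + (2 * t - 28) * linZ L S2 - linZ L S3 + 3 * linZ L S4 := by
  induction L with
  | nil => simp [linZ]
  | cons a r ih => simp only [linZ_cons]; rw [ih, GtW]; ring

/-- The (A1).2 rows of the profile LP force `Σ_N m·G_t = 64·G_t(x₀)` (word side). -/
theorem GtW_rows (D : Design) (x₀ : Cell) (t : ℤ)
    (hrow : ∀ w w' : Word, w.efree → w'.efree → w.deg = w'.deg →
      linZ D.N (fun c => icellCoef c w) - linZ D.N (fun c => icellCoef c w') = 64 * (icellCoef x₀ w - icellCoef x₀ w')) :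
    linZ D.N (GtW t) = 64 * GtW t x₀ := by
  rw [linZ_GtW, linZ_S1, linZ_S2, linZ_S3, linZ_S4]
  have e2P1 := hrow w3P1 w3P0 w3P1_efree w3P0_efree (w3P1_deg.trans w3P0_deg.symm)
  have e2P2 := hrow w3P2 w3P0 w3P2_efree w3P0_efree (w3P2_deg.trans w3P0_deg.symm)
  have e2P3 := hrow w3P3 w3P0 w3P3_efree w3P0_efree (w3P3_deg.trans w3P0_deg.symm)
  have e2H01 := hrow w3H01 w3P0 w3H01_efree w3P0_efree (w3H01_deg.trans w3P0_deg.symm)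
  have e2H02 := hrow w3H02 w3P0 w3H02_efree w3P0_efree (w3H02_deg.trans w3P0_deg.symm)
  have e2H03 := hrow w3H03 w3P0 w3H03_efree w3P0_efree (w3H03_deg.trans w3P0_deg.symm)
  have e2H12 := hrow w3H12 w3P0 w3H12_efree w3P0_efree (w3H12_deg.trans w3P0_deg.symm)
  have e2H13 := hrow w3H13 w3P0 w3H13_efree w3P0_efree (w3H13_deg.trans w3P0_deg.symm)
  have e2H23 := hrow w3H23 w3P0 w3H23_efree w3P0_efree (w3H23_deg.trans w3P0_deg.symm)
  have e3PH01 := hrow w3PH01 w3T0 w3PH01_efree w3T0_efree (w3PH01_deg.trans w3T0_deg.symm)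
  have e3PH02 := hrow w3PH02 w3T0 w3PH02_efree w3T0_efree (w3PH02_deg.trans w3T0_deg.symm)
  have e3PH03 := hrow w3PH03 w3T0 w3PH03_efree w3T0_efree (w3PH03_deg.trans w3T0_deg.symm)
  have e3PH10 := hrow w3PH10 w3T0 w3PH10_efree w3T0_efree (w3PH10_deg.trans w3T0_deg.symm)
  have e3PH12 := hrow w3PH12 w3T0 w3PH12_efree w3T0_efree (w3PH12_deg.trans w3T0_deg.symm)
  have e3PH13 := hrow w3PH13 w3T0 w3PH13_efree w3T0_efree (w3PH13_deg.trans w3T0_deg.symm)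
  have e3PH20 := hrow w3PH20 w3T0 w3PH20_efree w3T0_efree (w3PH20_deg.trans w3T0_deg.symm)
  have e3PH21 := hrow w3PH21 w3T0 w3PH21_efree w3T0_efree (w3PH21_deg.trans w3T0_deg.symm)
  have e3PH23 := hrow w3PH23 w3T0 w3PH23_efree w3T0_efree (w3PH23_deg.trans w3T0_deg.symm)
  have e3PH30 := hrow w3PH30 w3T0 w3PH30_efree w3T0_efree (w3PH30_deg.trans w3T0_deg.symm)
  have e3PH31 := hrow w3PH31 w3T0 w3PH31_efree w3T0_efree (w3PH31_deg.trans w3T0_deg.symm)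
  have e3PH32 := hrow w3PH32 w3T0 w3PH32_efree w3T0_efree (w3PH32_deg.trans w3T0_deg.symm)
  have e3T1 := hrow w3T1 w3T0 w3T1_efree w3T0_efree (w3T1_deg.trans w3T0_deg.symm)
  have e3T2 := hrow w3T2 w3T0 w3T2_efree w3T0_efree (w3T2_deg.trans w3T0_deg.symm)
  have e3T3 := hrow w3T3 w3T0 w3T3_efree w3T0_efree (w3T3_deg.trans w3T0_deg.symm)
  unfold GtW S1 S2 S3 S4
  linear_combination (42 - 3 * t) * (e2P1 + e2P2 + e2P3) + (2 * t - 28) * (e2H01 + e2H02 + e2H03 + e2H12 + e2H13 + e2H23)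
    - (e3PH01 + e3PH02 + e3PH03 + e3PH10 + e3PH12 + e3PH13 + e3PH20 + e3PH21 + e3PH23 + e3PH30 + e3PH31 + e3PH32)
    + 3 * (e3T1 + e3T2 + e3T3)

/-- values of `linZ` only depend on the positively weighted cells. -/
theorem linZ_congr_pos (L : List (Cell × ℕ)) (φ ψ : Cell → ℤ) (h : ∀ cm ∈ L, 0 < cm.2 → φ cm.1 = ψ cm.1) :
    linZ L φ = linZ L ψ := by
  induction L with
  | nil => simp [linZ]
  | cons a r ih =>
    rw [linZ_cons, linZ_cons, ih fun cm hcm => h cm (List.mem_cons_of_mem _ hcm)]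
    rcases Nat.eq_zero_or_pos a.2 with h0 | hpos
    · rw [h0]; simp
    · rw [h a List.mem_cons_self hpos]

theorem linZ_const_mul (L : List (Cell × ℕ)) (k : ℤ) (φ : Cell → ℤ) :
    linZ L (fun c => k * φ c) = k * linZ L φ := by
  induction L with
  | nil => simp [linZ]
  | cons a r ih => rw [linZ_cons, linZ_cons, ih]; ring

/-- lower-bound companion of `linZ_le_mul_sum`. -/
theorem mul_sum_le_linZ (L : List (Cell × ℕ)) (φ : Cell → ℤ) (b : ℤ) (h : ∀ cm ∈ L, 0 < cm.2 → b ≤ φ cm.1) :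
    b * ((L.map Prod.snd).sum : ℕ) ≤ linZ L φ := by
  induction L with
  | nil => simp [linZ]
  | cons a r ih =>
    rw [linZ_cons, List.map_cons, List.sum_cons, Nat.cast_add, mul_add]
    have ht := ih fun cm hcm => h cm (List.mem_cons_of_mem _ hcm)
    rcases Nat.eq_zero_or_pos a.2 with h0 | hpos
    · rw [h0, Nat.cast_zero, zero_mul, mul_zero]
      linarith
    · have ha : b ≤ φ a.1 := h a List.mem_cons_self hpos
      have hm : (0 : ℤ) ≤ (a.2 : ℤ) := by exact_mod_cast Nat.zero_le _
      have hprod : (a.2 : ℤ) * b ≤ (a.2 : ℤ) * φ a.1 := mul_le_mul_of_nonneg_left ha hm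
      linarith

/-- The co-level form of the row identity: for a design whose supports lie on the height-14 alphabet. -/
theorem GtC_rows (D : Design) (x₀ : Cell) (t : ℤ) (hA : D.OnAlphabet 14) (hx₀ : x₀ ∈ D.suppP)
    (hrow : ∀ w w' : Word, w.efree → w'.efree → w.deg = w'.deg →
      linZ D.N (fun c => icellCoef c w) - linZ D.N (fun c => icellCoef c w') = 64 * (icellCoef x₀ w - icellCoef x₀ w')) :
    linZ D.N (GtC t) = 64 * GtC t x₀ := by
  have hx : ∀ f, (x₀ f).OnAlphabet 14 := fun f => hA x₀ (List.mem_append.mpr (Or.inr hx₀)) f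
  have hN : linZ D.N (GtC t) = linZ D.N (GtW t) := by
    apply linZ_congr_pos
    intro cm hcm hpos
    have hmem : cm.1 ∈ D.suppN := (mem_suppN_iff D cm.1).mpr ⟨cm.2, by simpa using hcm, hpos⟩
    exact (GtW_eq_GtC t cm.1 fun f => hA cm.1 (List.mem_append.mpr (Or.inl hmem)) f).symm
  rw [hN, GtW_rows D x₀ t hrow, GtW_eq_GtC t x₀ hx]

/-! ## §2 The triangle lemma -/

/-- quarter turns permute `(|x|, |y|)`. -/
theorem rotPow_abs (j : ℕ) (ℓ : Letter) :
    (|(ℓ.rotPow j).x| = |ℓ.x| ∧ |(ℓ.rotPow j).y| = |ℓ.y|) ∨ (|(ℓ.rotPow j).x| = |ℓ.y| ∧ |(ℓ.rotPow j).y| = |ℓ.x|) := by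
  induction j generalizing ℓ with
  | zero => left; exact ⟨rfl, rfl⟩
  | succ j ih =>
    rw [rotPow_succ]
    have h1 : |ℓ.rotI.x| = |ℓ.y| := by cases ℓ; simp [Letter.rotI, abs_neg]
    have h2 : |ℓ.rotI.y| = |ℓ.x| := by cases ℓ; simp [Letter.rotI]
    rcases ih ℓ.rotI with ⟨e1, e2⟩ | ⟨e1, e2⟩
    · right; exact ⟨e1.trans h1, e2.trans h2⟩
    · left; exact ⟨e1.trans h2, e2.trans h1⟩

/-- STRICT-SHRINK BOX: every N-letter lies strictly inside the box of the corresponding `x₀`-letter, up to the `x ↔ y` swap of a quarter turn. -/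
theorem N_in_box (D : Design) (hS : D.S0Invariant) (hA : D.OnAlphabet 14) (h4 : D.A4sharp) (hC : D.CONN)
    (hB : D.copies ≤ 199) (hr : 8 ≤ D.rank) (x₀ : Cell) (hx₀ : x₀ ∈ D.suppP) :
    ∀ y ∈ D.suppN, ∀ f : Fin 4,
      (|(y f).x| + 1 ≤ |(x₀ f).x| ∧ |(y f).y| + 1 ≤ |(x₀ f).y|) ∨ (|(y f).x| + 1 ≤ |(x₀ f).y| ∧ |(y f).y| + 1 ≤ |(x₀ f).x|) := by
  intro y hy f
  obtain ⟨k, hk, hlive⟩ := N_above_orbit D hS hA h4 hC hB hr x₀ hx₀ y hy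
  have hxs : rotCell k x₀ ∈ D.suppP := by
    rw [mem_suppP_iff_mP_pos, mP_rotCell D hS k hk x₀]
    exact (mem_suppP_iff_mP_pos D x₀).mp hx₀
  have hxA : (rotCell k x₀ f).OnAlphabet 14 := hA _ (List.mem_append.mpr (Or.inr hxs)) f
  have hyA : (y f).OnAlphabet 14 := hA y (List.mem_append.mpr (Or.inl hy)) f
  have hss := strict_shrink (rotCell k x₀ f) (y f) (hxA.1.trans hyA.1.symm) (hlive f)
  have hrot : rotCell k x₀ f = (x₀ f).rotPow (k f).val := rfl
  rw [hrot] at hss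
  rcases rotPow_abs (k f).val (x₀ f) with ⟨e1, e2⟩ | ⟨e1, e2⟩
  · left; rw [← e1, ← e2]; exact hss
  · right; rw [← e1, ← e2]; exact hss

/-- barycentric weights of the triangle `{o = (0,0), a = (Q,0), F = (P+Q, 2PQ)}` at the box letter `(u,v)` (total weight `P·Q²`). -/
def Wo (P Q u v : ℤ) : ℤ := P * ((Q - u) * (Q - v))
/-- weight of the axis tip. -/
def Wa (P Q u v : ℤ) : ℤ := P * Q * (u + v) - (P + Q) * (u * v)
/-- weight of the retreat. -/
def WF (_P Q u v : ℤ) : ℤ := Q * (u * v)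

theorem W_nonneg (P Q u v : ℤ) (hP : 0 ≤ P) (hPQ : P ≤ Q) (hu : 0 ≤ u) (hv : 0 ≤ v)
    (hbox : (u ≤ P ∧ v ≤ Q) ∨ (u ≤ Q ∧ v ≤ P)) : 0 ≤ Wo P Q u v ∧ 0 ≤ Wa P Q u v ∧ 0 ≤ WF P Q u v := by
  refine ⟨?_, ?_, ?_⟩
  · unfold Wo
    apply mul_nonneg hP
    apply mul_nonneg <;> rcases hbox with ⟨h1, h2⟩ | ⟨h1, h2⟩ <;> linarith
  · rcases hbox with ⟨h1, h2⟩ | ⟨h1, h2⟩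
    · have e : Wa P Q u v = P * u * (Q - v) + Q * v * (P - u) := by unfold Wa; ring
      rw [e]
      apply add_nonneg
      · exact mul_nonneg (mul_nonneg hP hu) (by linarith)
      · exact mul_nonneg (mul_nonneg (le_trans hP hPQ) hv) (by linarith)
    · have e : Wa P Q u v = P * v * (Q - u) + Q * u * (P - v) := by unfold Wa; ring
      rw [e]
      apply add_nonneg
      · exact mul_nonneg (mul_nonneg hP hv) (by linarith)
      · exact mul_nonneg (mul_nonneg (le_trans hP hPQ) hu) (by linarith)
  · unfold WF
    exact mul_nonneg (le_trans hP hPQ) (mul_nonneg hu hv)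

theorem W_sum (P Q u v : ℤ) : Wo P Q u v + Wa P Q u v + WF P Q u v = P * Q ^ 2 := by
  unfold Wo Wa WF; ring

/-- `G_t` is affine in factor 0's `(1, c₀, δ₀)`: barycentric identity, slot 0. -/
theorem bary_slot0 (t P Q u v c1 c2 c3 d1 d2 d3 : ℤ) :
    P * Q ^ 2 * Gt t (u + v) c1 c2 c3 (2 * (u * v)) d1 d2 d3 =
      Wo P Q u v * Gt t 0 c1 c2 c3 0 d1 d2 d3 + Wa P Q u v * Gt t Q c1 c2 c3 0 d1 d2 d3
      + WF P Q u v * Gt t (P + Q) c1 c2 c3 (2 * (P * Q)) d1 d2 d3 := by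
  unfold Gt Wo Wa WF; ring

theorem bary_slot1 (t P Q u v c0 c2 c3 d0 d2 d3 : ℤ) :
    P * Q ^ 2 * Gt t c0 (u + v) c2 c3 d0 (2 * (u * v)) d2 d3 =
      Wo P Q u v * Gt t c0 0 c2 c3 d0 0 d2 d3 + Wa P Q u v * Gt t c0 Q c2 c3 d0 0 d2 d3
      + WF P Q u v * Gt t c0 (P + Q) c2 c3 d0 (2 * (P * Q)) d2 d3 := by
  unfold Gt Wo Wa WF; ring

theorem bary_slot2 (t P Q u v c0 c1 c3 d0 d1 d3 : ℤ) :
    P * Q ^ 2 * Gt t c0 c1 (u + v) c3 d0 d1 (2 * (u * v)) d3 =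
      Wo P Q u v * Gt t c0 c1 0 c3 d0 d1 0 d3 + Wa P Q u v * Gt t c0 c1 Q c3 d0 d1 0 d3
      + WF P Q u v * Gt t c0 c1 (P + Q) c3 d0 d1 (2 * (P * Q)) d3 := by
  unfold Gt Wo Wa WF; ring

theorem bary_slot3 (t P Q u v c0 c1 c2 d0 d1 d2 : ℤ) :
    P * Q ^ 2 * Gt t c0 c1 c2 (u + v) d0 d1 d2 (2 * (u * v)) =
      Wo P Q u v * Gt t c0 c1 c2 0 d0 d1 d2 0 + Wa P Q u v * Gt t c0 c1 c2 Q d0 d1 d2 0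
      + WF P Q u v * Gt t c0 c1 c2 (P + Q) d0 d1 d2 (2 * (P * Q)) := by
  unfold Gt Wo Wa WF; ring

/-- one convexity step: a lower bound at the three vertices of a slot propagates to every box letter of that slot. -/
theorem hull_step (P Q u v g X Xo Xa XF : ℤ) (hP : 1 ≤ P) (hPQ : P ≤ Q) (hu : 0 ≤ u) (hv : 0 ≤ v)
    (hbox : (u ≤ P ∧ v ≤ Q) ∨ (u ≤ Q ∧ v ≤ P))
    (hid : P * Q ^ 2 * X = Wo P Q u v * Xo + Wa P Q u v * Xa + WF P Q u v * XF)
    (ho : g ≤ Xo) (ha : g ≤ Xa) (hF : g ≤ XF) : g ≤ X := by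
  obtain ⟨w1, w2, w3⟩ := W_nonneg P Q u v (by linarith) hPQ hu hv hbox
  have hs := W_sum P Q u v
  have hpos : 0 < P * Q ^ 2 := by
    have hQ : 1 ≤ Q := le_trans hP hPQ
    positivity
  have key : P * Q ^ 2 * (X - g) = Wo P Q u v * (Xo - g) + Wa P Q u v * (Xa - g) + WF P Q u v * (XF - g) := by
    have : P * Q ^ 2 * g = (Wo P Q u v + Wa P Q u v + WF P Q u v) * g := by rw [hs]
    linear_combination hid - this
  have hnn : 0 ≤ P * Q ^ 2 * (X - g) := by
    rw [key]
    apply add_nonneg (add_nonneg _ _) _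
    · exact mul_nonneg w1 (by linarith)
    · exact mul_nonneg w2 (by linarith)
    · exact mul_nonneg w3 (by linarith)
  have : 0 ≤ X - g := by
    by_contra hc
    push Not at hc
    have : P * Q ^ 2 * (X - g) < 0 := mul_neg_of_pos_of_neg hpos hc
    linarith
  linarith

/-- vertex co-levels `(0, Q, P+Q)` and vertex deltas `(0, 0, 2PQ)` of the triangle. -/
def VC (P Q : ℤ) : Fin 3 → ℤ := ![0, Q, P + Q]
/-- vertex deltas. -/
def VD (P Q : ℤ) : Fin 3 → ℤ := ![0, 0, 2 * (P * Q)]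

/-- a box letter of a fat factor: `0 ≤ u, v`, inside the box up to the swap. -/
def InBox (P Q u v : ℤ) : Prop := 0 ≤ u ∧ 0 ≤ v ∧ ((u ≤ P ∧ v ≤ Q) ∨ (u ≤ Q ∧ v ≤ P))

/-- THE TRIANGLE LEMMA (fat type, `1 ≤ P ≤ Q`): a lower bound for `135·G_t` on the 81 vertex cells holds on every cell of box letters. -/
theorem hull_fat (t P Q g : ℤ) (hP : 1 ≤ P) (hPQ : P ≤ Q)
    (h81 : ∀ i j k l : Fin 3, g ≤ 135 * Gt t (VC P Q i) (VC P Q j) (VC P Q k) (VC P Q l) (VD P Q i) (VD P Q j) (VD P Q k) (VD P Q l))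
    (u0 v0 u1 v1 u2 v2 u3 v3 : ℤ) (h0 : InBox P Q u0 v0) (h1 : InBox P Q u1 v1) (h2 : InBox P Q u2 v2) (h3 : InBox P Q u3 v3) :
    g ≤ 135 * Gt t (u0 + v0) (u1 + v1) (u2 + v2) (u3 + v3) (2 * (u0 * v0)) (2 * (u1 * v1)) (2 * (u2 * v2)) (2 * (u3 * v3)) := by
  have hV0 : ∀ P Q : ℤ, VC P Q 0 = 0 ∧ VD P Q 0 = 0 := fun P Q => ⟨rfl, rfl⟩
  have hV1 : ∀ P Q : ℤ, VC P Q 1 = Q ∧ VD P Q 1 = 0 := fun P Q => ⟨rfl, rfl⟩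
  have hV2 : ∀ P Q : ℤ, VC P Q 2 = P + Q ∧ VD P Q 2 = 2 * (P * Q) := fun P Q => ⟨rfl, rfl⟩
  -- slot 3 free, slots 0,1,2 at vertices
  have s3 : ∀ i j k : Fin 3, g ≤ 135 * Gt t (VC P Q i) (VC P Q j) (VC P Q k) (u3 + v3) (VD P Q i) (VD P Q j) (VD P Q k) (2 * (u3 * v3)) := by
    intro i j k
    refine hull_step P Q u3 v3 g _ _ _ _ hP hPQ h3.1 h3.2.1 h3.2.2 ?_ (h81 i j k 0) (h81 i j k 1) (h81 i j k 2)
    rw [(hV0 P Q).1, (hV0 P Q).2, (hV1 P Q).1, (hV1 P Q).2, (hV2 P Q).1, (hV2 P Q).2]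
    have e := bary_slot3 t P Q u3 v3 (VC P Q i) (VC P Q j) (VC P Q k) (VD P Q i) (VD P Q j) (VD P Q k)
    linear_combination 135 * e
  have s2 : ∀ i j : Fin 3, g ≤ 135 * Gt t (VC P Q i) (VC P Q j) (u2 + v2) (u3 + v3) (VD P Q i) (VD P Q j) (2 * (u2 * v2)) (2 * (u3 * v3)) := by
    intro i j
    refine hull_step P Q u2 v2 g _ _ _ _ hP hPQ h2.1 h2.2.1 h2.2.2 ?_ (s3 i j 0) (s3 i j 1) (s3 i j 2)
    rw [(hV0 P Q).1, (hV0 P Q).2, (hV1 P Q).1, (hV1 P Q).2, (hV2 P Q).1, (hV2 P Q).2]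
    have e := bary_slot2 t P Q u2 v2 (VC P Q i) (VC P Q j) (u3 + v3) (VD P Q i) (VD P Q j) (2 * (u3 * v3))
    linear_combination 135 * e
  have s1 : ∀ i : Fin 3, g ≤ 135 * Gt t (VC P Q i) (u1 + v1) (u2 + v2) (u3 + v3) (VD P Q i) (2 * (u1 * v1)) (2 * (u2 * v2)) (2 * (u3 * v3)) := by
    intro i
    refine hull_step P Q u1 v1 g _ _ _ _ hP hPQ h1.1 h1.2.1 h1.2.2 ?_ (s2 i 0) (s2 i 1) (s2 i 2)
    rw [(hV0 P Q).1, (hV0 P Q).2, (hV1 P Q).1, (hV1 P Q).2, (hV2 P Q).1, (hV2 P Q).2]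
    have e := bary_slot1 t P Q u1 v1 (VC P Q i) (u2 + v2) (u3 + v3) (VD P Q i) (2 * (u2 * v2)) (2 * (u3 * v3))
    linear_combination 135 * e
  refine hull_step P Q u0 v0 g _ _ _ _ hP hPQ h0.1 h0.2.1 h0.2.2 ?_ (s1 0) (s1 1) (s1 2)
  rw [(hV0 P Q).1, (hV0 P Q).2, (hV1 P Q).1, (hV1 P Q).2, (hV2 P Q).1, (hV2 P Q).2]
  have e := bary_slot0 t P Q u0 v0 (u1 + v1) (u2 + v2) (u3 + v3) (2 * (u1 * v1)) (2 * (u2 * v2)) (2 * (u3 * v3))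
  linear_combination 135 * e

/-- segment identity for a thin factor (`δ = 0`): `G_t` is affine in `c₀`. -/
theorem seg_slot0 (t Q c c1 c2 c3 d1 d2 d3 : ℤ) :
    Q * Gt t c c1 c2 c3 0 d1 d2 d3 = (Q - c) * Gt t 0 c1 c2 c3 0 d1 d2 d3 + c * Gt t Q c1 c2 c3 0 d1 d2 d3 := by
  unfold Gt; ring
theorem seg_slot1 (t Q c c0 c2 c3 d0 d2 d3 : ℤ) :
    Q * Gt t c0 c c2 c3 d0 0 d2 d3 = (Q - c) * Gt t c0 0 c2 c3 d0 0 d2 d3 + c * Gt t c0 Q c2 c3 d0 0 d2 d3 := by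
  unfold Gt; ring
theorem seg_slot2 (t Q c c0 c1 c3 d0 d1 d3 : ℤ) :
    Q * Gt t c0 c1 c c3 d0 d1 0 d3 = (Q - c) * Gt t c0 c1 0 c3 d0 d1 0 d3 + c * Gt t c0 c1 Q c3 d0 d1 0 d3 := by
  unfold Gt; ring
theorem seg_slot3 (t Q c c0 c1 c2 d0 d1 d2 : ℤ) :
    Q * Gt t c0 c1 c2 c d0 d1 d2 0 = (Q - c) * Gt t c0 c1 c2 0 d0 d1 d2 0 + c * Gt t c0 c1 c2 Q d0 d1 d2 0 := by
  unfold Gt; ring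

/-- one convexity step on a segment. -/
theorem seg_step (Q c g X Xo Xa : ℤ) (hc0 : 0 ≤ c) (hcQ : c ≤ Q)
    (hid : Q * X = (Q - c) * Xo + c * Xa) (hzero : c = 0 → X = Xo) (ho : g ≤ Xo) (ha : g ≤ Xa) : g ≤ X := by
  rcases eq_or_lt_of_le hc0 with h | h
  · rw [hzero h.symm]; exact ho
  · have hQpos : 0 < Q := lt_of_lt_of_le h hcQ
    have key : Q * (X - g) = (Q - c) * (Xo - g) + c * (Xa - g) := by linear_combination hid
    have hnn : 0 ≤ Q * (X - g) := by
      rw [key]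
      exact add_nonneg (mul_nonneg (by linarith) (by linarith)) (mul_nonneg hc0 (by linarith))
    have : 0 ≤ X - g := by
      by_contra hc
      push Not at hc
      have : Q * (X - g) < 0 := mul_neg_of_pos_of_neg hQpos hc
      linarith
    linarith

/-- segment vertices `(0, Q)` of a thin factor. -/
def VS (Q : ℤ) : Fin 2 → ℤ := ![0, Q]

/-- THE SEGMENT LEMMA (thin type, `P = 0`): a lower bound for `135·G_t` on the 16 vertex cells holds on every cell of axis letters of co-level `≤ Q`. -/
theorem hull_thin (t Q g : ℤ)
    (h16 : ∀ i j k l : Fin 2, g ≤ 135 * Gt t (VS Q i) (VS Q j) (VS Q k) (VS Q l) 0 0 0 0)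
    (c0 c1 c2 c3 : ℤ) (h0 : 0 ≤ c0 ∧ c0 ≤ Q) (h1 : 0 ≤ c1 ∧ c1 ≤ Q) (h2 : 0 ≤ c2 ∧ c2 ≤ Q) (h3 : 0 ≤ c3 ∧ c3 ≤ Q) :
    g ≤ 135 * Gt t c0 c1 c2 c3 0 0 0 0 := by
  have hV0 : ∀ Q : ℤ, VS Q 0 = 0 := fun Q => rfl
  have hV1 : ∀ Q : ℤ, VS Q 1 = Q := fun Q => rfl
  have s3 : ∀ i j k : Fin 2, g ≤ 135 * Gt t (VS Q i) (VS Q j) (VS Q k) c3 0 0 0 0 := by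
    intro i j k
    refine seg_step Q c3 g _ _ _ h3.1 h3.2 ?_ (fun h => by rw [h, ← hV0 Q]) (h16 i j k 0) (h16 i j k 1)
    rw [hV0 Q, hV1 Q]
    have e := seg_slot3 t Q c3 (VS Q i) (VS Q j) (VS Q k) 0 0 0
    linear_combination 135 * e
  have s2 : ∀ i j : Fin 2, g ≤ 135 * Gt t (VS Q i) (VS Q j) c2 c3 0 0 0 0 := by
    intro i j
    refine seg_step Q c2 g _ _ _ h2.1 h2.2 ?_ (fun h => by rw [h, ← hV0 Q]) (s3 i j 0) (s3 i j 1)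
    rw [hV0 Q, hV1 Q]
    have e := seg_slot2 t Q c2 (VS Q i) (VS Q j) c3 0 0 0
    linear_combination 135 * e
  have s1 : ∀ i : Fin 2, g ≤ 135 * Gt t (VS Q i) c1 c2 c3 0 0 0 0 := by
    intro i
    refine seg_step Q c1 g _ _ _ h1.1 h1.2 ?_ (fun h => by rw [h, ← hV0 Q]) (s2 i 0) (s2 i 1)
    rw [hV0 Q, hV1 Q]
    have e := seg_slot1 t Q c1 (VS Q i) c2 c3 0 0 0
    linear_combination 135 * e
  refine seg_step Q c0 g _ _ _ h0.1 h0.2 ?_ (fun h => by rw [h, ← hV0 Q]) (s1 0) (s1 1)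
  rw [hV0 Q, hV1 Q]
  have e := seg_slot0 t Q c0 c1 c2 c3 0 0 0
  linear_combination 135 * e

/-! ## §3 DB-SYM for isotypic profiles -/

/-- `x₀` is ISOTYPIC of type `(p, q)`: every letter has `{|x|, |y|} = {p, q}`. -/
def Iso (p q : ℤ) (x₀ : Cell) : Prop :=
  ∀ f : Fin 4, (|(x₀ f).x| = p ∧ |(x₀ f).y| = q) ∨ (|(x₀ f).x| = q ∧ |(x₀ f).y| = p)

/-- DB-SYM restricted to isotypic seeds of type `(p,q)`: the hypotheses of `DBSymProfile` (without its last, `(A1).4`-type, hypothesis)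
are contradictory. -/
def IsoKill (p q : ℤ) : Prop :=
  ∀ D : Design, ∀ x₀ : Cell, D.S0Invariant → D.OnAlphabet 14 → D.A4sharp → D.CONN → D.copies ≤ 199 → 8 ≤ D.rank →
    x₀ ∈ D.suppP → Iso p q x₀ →
    (∀ w w' : Word, w.efree → w'.efree → w.deg = w'.deg →
      linZ D.N (fun c => icellCoef c w) - linZ D.N (fun c => icellCoef c w') = 64 * (icellCoef x₀ w - icellCoef x₀ w')) → False

/-- the uniform integer choice of `t`: `t = c₀ − 1 − min(p, 4)` (inside colour-1's window for all 49 types). -/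
def tOf (p q : ℤ) : ℤ := p + q - 1 - min p 4

/-- `G_t(x₀)` for the isotypic seed of type `(p,q)`. -/
def G0 (p q : ℤ) : ℤ :=
  Gt (tOf p q) (p + q) (p + q) (p + q) (p + q) (2 * (p * q)) (2 * (p * q)) (2 * (p * q)) (2 * (p * q))

/-- the budget step: `Σ_N m·G = 64·G(x₀)`, `G ≥ (64 G(x₀)+1)/135` pointwise on N, `72 ≤ Σ_N m ≤ 135`, `G(x₀) < 0` are contradictory. -/
theorem budget_contra (g₀ : ℤ) (M : ℕ) (hneg : g₀ < 0) (h72 : 72 ≤ M) (h135 : M ≤ 135)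
    (hlow : (64 * g₀ + 1) * (M : ℤ) ≤ 135 * (64 * g₀)) : False := by
  have hM : (M : ℤ) ≤ 135 := by exact_mod_cast h135
  have hM' : (72 : ℤ) ≤ (M : ℤ) := by exact_mod_cast h72
  nlinarith

/-- FAT TYPES (`2 ≤ p ≤ q`): the 81 vertex checks + `G_t(x₀) < 0` kill every isotypic `(p,q)` design. -/
theorem iso_fat (p q : ℤ) (hp : 2 ≤ p) (hpq : p ≤ q) (hneg : G0 p q < 0)
    (h81 : ∀ i j k l : Fin 3, 64 * G0 p q + 1 ≤
        135 * Gt (tOf p q) (VC (p - 1) (q - 1) i) (VC (p - 1) (q - 1) j) (VC (p - 1) (q - 1) k) (VC (p - 1) (q - 1) l)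
          (VD (p - 1) (q - 1) i) (VD (p - 1) (q - 1) j) (VD (p - 1) (q - 1) k) (VD (p - 1) (q - 1) l)) :
    IsoKill p q := by
  intro D x₀ hS hA h4 hC hB hr hx₀ hiso hrow
  have hx0c : ∀ f, (x₀ f).colevel = p + q ∧ dlt (x₀ f) = 2 * (p * q) := by
    intro f
    unfold Letter.colevel dlt
    rcases hiso f with ⟨e1, e2⟩ | ⟨e1, e2⟩ <;> rw [e1, e2] <;> constructor <;> ring
  have hG0 : GtC (tOf p q) x₀ = G0 p q := by
    unfold GtC G0
    rw [(hx0c 0).1, (hx0c 1).1, (hx0c 2).1, (hx0c 3).1, (hx0c 0).2, (hx0c 1).2, (hx0c 2).2, (hx0c 3).2]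
  have hrows := GtC_rows D x₀ (tOf p q) hA hx₀ hrow
  have hpt : ∀ cm ∈ D.N, 0 < cm.2 → 64 * G0 p q + 1 ≤ (fun c => 135 * GtC (tOf p q) c) cm.1 := by
    intro cm hcm hpos
    have hmem : cm.1 ∈ D.suppN := (mem_suppN_iff D cm.1).mpr ⟨cm.2, by simpa using hcm, hpos⟩
    have hbox := N_in_box D hS hA h4 hC hB hr x₀ hx₀ cm.1 hmem
    have hin : ∀ f, InBox (p - 1) (q - 1) |(cm.1 f).x| |(cm.1 f).y| := by
      intro f
      refine ⟨abs_nonneg _, abs_nonneg _, ?_⟩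
      rcases hbox f with ⟨b1, b2⟩ | ⟨b1, b2⟩ <;> rcases hiso f with ⟨e1, e2⟩ | ⟨e1, e2⟩
      · left; constructor <;> linarith
      · right; constructor <;> linarith
      · right; constructor <;> linarith
      · left; constructor <;> linarith
    exact hull_fat (tOf p q) (p - 1) (q - 1) (64 * G0 p q + 1) (by linarith) (by linarith) h81 _ _ _ _ _ _ _ _
      (hin 0) (hin 1) (hin 2) (hin 3)
  have hlow := mul_sum_le_linZ D.N (fun c => 135 * GtC (tOf p q) c) (64 * G0 p q + 1) hpt
  rw [linZ_const_mul, hrows, hG0] at hlow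
  obtain ⟨-, h72, h135⟩ := sumN_window D hS hA h4 hC hB hr x₀ hx₀
  exact budget_contra (G0 p q) _ hneg h72 h135 hlow

/-- THIN TYPES (`p = 1`): the 16 segment-vertex checks + `G_t(x₀) < 0` kill every isotypic `(1,q)` design. -/
theorem iso_thin (q : ℤ) (_hq : 1 ≤ q) (hneg : G0 1 q < 0)
    (h16 : ∀ i j k l : Fin 2, 64 * G0 1 q + 1 ≤
        135 * Gt (tOf 1 q) (VS (q - 1) i) (VS (q - 1) j) (VS (q - 1) k) (VS (q - 1) l) 0 0 0 0) :
    IsoKill 1 q := by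
  intro D x₀ hS hA h4 hC hB hr hx₀ hiso hrow
  have hx0c : ∀ f, (x₀ f).colevel = 1 + q ∧ dlt (x₀ f) = 2 * (1 * q) := by
    intro f
    unfold Letter.colevel dlt
    rcases hiso f with ⟨e1, e2⟩ | ⟨e1, e2⟩ <;> rw [e1, e2] <;> constructor <;> ring
  have hG0 : GtC (tOf 1 q) x₀ = G0 1 q := by
    unfold GtC G0
    rw [(hx0c 0).1, (hx0c 1).1, (hx0c 2).1, (hx0c 3).1, (hx0c 0).2, (hx0c 1).2, (hx0c 2).2, (hx0c 3).2]
  have hrows := GtC_rows D x₀ (tOf 1 q) hA hx₀ hrow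
  have hpt : ∀ cm ∈ D.N, 0 < cm.2 → 64 * G0 1 q + 1 ≤ (fun c => 135 * GtC (tOf 1 q) c) cm.1 := by
    intro cm hcm hpos
    have hmem : cm.1 ∈ D.suppN := (mem_suppN_iff D cm.1).mpr ⟨cm.2, by simpa using hcm, hpos⟩
    have hbox := N_in_box D hS hA h4 hC hB hr x₀ hx₀ cm.1 hmem
    -- each N-letter is an axis letter of co-level ≤ q − 1
    have hax : ∀ f, (0 ≤ (cm.1 f).colevel ∧ (cm.1 f).colevel ≤ q - 1) ∧ dlt (cm.1 f) = 0 := by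
      intro f
      have hu := abs_nonneg (cm.1 f).x
      have hv := abs_nonneg (cm.1 f).y
      unfold Letter.colevel dlt
      rcases hbox f with ⟨b1, b2⟩ | ⟨b1, b2⟩ <;> rcases hiso f with ⟨e1, e2⟩ | ⟨e1, e2⟩
      · have h0 : |(cm.1 f).x| = 0 := by linarith
        exact ⟨⟨by linarith, by linarith⟩, by rw [h0]; ring⟩
      · have h0 : |(cm.1 f).y| = 0 := by linarith
        exact ⟨⟨by linarith, by linarith⟩, by rw [h0]; ring⟩
      · have h0 : |(cm.1 f).y| = 0 := by linarith
        exact ⟨⟨by linarith, by linarith⟩, by rw [h0]; ring⟩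
      · have h0 : |(cm.1 f).x| = 0 := by linarith
        exact ⟨⟨by linarith, by linarith⟩, by rw [h0]; ring⟩
    show 64 * G0 1 q + 1 ≤ 135 * GtC (tOf 1 q) cm.1
    unfold GtC
    rw [(hax 0).2, (hax 1).2, (hax 2).2, (hax 3).2]
    exact hull_thin (tOf 1 q) (q - 1) (64 * G0 1 q + 1) h16 _ _ _ _ (hax 0).1 (hax 1).1 (hax 2).1 (hax 3).1
  have hlow := mul_sum_le_linZ D.N (fun c => 135 * GtC (tOf 1 q) c) (64 * G0 1 q + 1) hpt
  rw [linZ_const_mul, hrows, hG0] at hlow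
  obtain ⟨-, h72, h135⟩ := sumN_window D hS hA h4 hC hB hr x₀ hx₀
  exact budget_contra (G0 1 q) _ hneg h72 h135 hlow

/-- DB-SYM FOR ALL 49 ISOTYPIC TYPES `(p,q)`, `1 ≤ p ≤ q`, `p + q ≤ 14` (height 14): the uniform integer `t = p + q − 1 − min(p,4)`
and the `3⁴` (thin: `2⁴`) vertex inequalities, decided per type. -/
theorem dbSymProfile_iso (p q : ℤ) (h1 : 1 ≤ p) (hpq : p ≤ q) (h14 : p + q ≤ 14) : IsoKill p q := by
  have hp7 : p ≤ 7 := by linarith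
  have hq13 : q ≤ 13 := by linarith
  interval_cases p <;> interval_cases q
  all_goals first
    | (exfalso; linarith)
    | exact iso_thin _ (by norm_num) (by decide) (by decide)
    | exact iso_fat _ _ (by norm_num) (by norm_num) (by decide) (by decide)

/-- The same in the binder shape of `DBSymProfile`, for an isotypic `x₀` (the type is read off `x₀ 0`). -/
theorem dbSymProfile_of_iso (D : Design) (x₀ : Cell) (hS : D.S0Invariant) (hA : D.OnAlphabet 14) (h4 : D.A4sharp)
    (hC : D.CONN) (hB : D.copies ≤ 199) (hr : 8 ≤ D.rank) (hx₀ : x₀ ∈ D.suppP)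
    (hiso : Iso |(x₀ 0).x| |(x₀ 0).y| x₀ ∨ Iso |(x₀ 0).y| |(x₀ 0).x| x₀)
    (hrow : ∀ w w' : Word, w.efree → w'.efree → w.deg = w'.deg →
      linZ D.N (fun c => icellCoef c w) - linZ D.N (fun c => icellCoef c w') = 64 * (icellCoef x₀ w - icellCoef x₀ w')) :
    False := by
  have hxA : (x₀ 0).OnAlphabet 14 := hA x₀ (List.mem_append.mpr (Or.inr hx₀)) 0
  have hx : (x₀ 0).x ≠ 0 := suppP_x_ne_zero D hA h4 hC x₀ hx₀ 0
  -- `y ≠ 0` too: an N-letter sits strictly inside the box (`N_in_box`), so both box sides are ≥ 1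
  obtain ⟨y, hy⟩ := exists_suppN_of_rank D hr
  have hb := N_in_box D hS hA h4 hC hB hr x₀ hx₀ y hy 0
  have hux := abs_nonneg (y 0).x
  have huy := abs_nonneg (y 0).y
  have hpx : 1 ≤ |(x₀ 0).x| := by rcases hb with ⟨b1, b2⟩ | ⟨b1, b2⟩ <;> linarith
  have hpy : 1 ≤ |(x₀ 0).y| := by rcases hb with ⟨b1, b2⟩ | ⟨b1, b2⟩ <;> linarith
  have hsum : |(x₀ 0).x| + |(x₀ 0).y| ≤ 14 := by
    obtain ⟨hh, ha⟩ := hxA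
    unfold Letter.height at hh
    linarith
  rcases le_total |(x₀ 0).x| |(x₀ 0).y| with hle | hle
  · have hI : Iso |(x₀ 0).x| |(x₀ 0).y| x₀ := by
      rcases hiso with h | h
      · exact h
      · intro f; rcases h f with ⟨e1, e2⟩ | ⟨e1, e2⟩
        · right; exact ⟨e1, e2⟩
        · left; exact ⟨e1, e2⟩
    exact dbSymProfile_iso _ _ hpx hle hsum D x₀ hS hA h4 hC hB hr hx₀ hI hrow
  · have hI : Iso |(x₀ 0).y| |(x₀ 0).x| x₀ := by
      rcases hiso with h | h
      · intro f; rcases h f with ⟨e1, e2⟩ | ⟨e1, e2⟩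
        · right; exact ⟨e1, e2⟩
        · left; exact ⟨e1, e2⟩
      · exact h
    exact dbSymProfile_iso _ _ hpy hle (by linarith) D x₀ hS hA h4 hC hB hr hx₀ hI hrow

end vertexform

end Summit.HodgeConjecture.HodgeConjecture.Cruxes.BlochSeedDiscOne.DepthBoundA4
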